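import Literature.Geometry.Kaehler.ComplexTorusIntegralHodgeLatticePrimitiveSplitting
import HarnessLib

/-!
# The two ends of the primitive splitting: `NS(X) ⊇ NS(X)_prim ⊕ (a positive line ∋ θ)` (`p = 1`) and, on an abelian fourfold,
# `Hdg²(X, ℤ) ⊇ Hdg²(X, ℤ)_prim ⊕ (a hyperbolic lattice of rank ρ(X) ∋ θ ∧ NS(X))` (`p = 2 = g/2`)

Layer `Literature/Geometry/Kaehler`, namespace `Literature.Geometry.Kaehler.ComplexTorus`; lane `lit-hodgefound`
(Track 2 foundations library), seat p09, generation 46, row g46-#10. THEOREMS ONLY (0 definitions); no named fact, net debt 0.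
Instances of g46-#9 (`ComplexTorusIntegralHodgeLatticePrimitiveSplitting`: inside `M = Hdgᵖ(X, ℤ)` the primitive Hodge lattice `P` and its
`B_{2p}`-orthogonal `P^⊥` are disjoint of finite index dividing `|det G_P|`, `det G_P · det G_{P^⊥} = index² · det G_M`, and `P^⊥` has the rank
and the signature of `Hdgᵖ⁻¹(X, ℤ)` and contains `θ ∧ H^{2p−2}(X, ℤ) ∩ Hdgᵖ(X, ℤ)`) at the two ends where everything is explicit:

* `p = 1` (§1): `M = Hdg¹(X, ℤ) ≅ NS(X)` with the Lefschetz form `B₂ = ⟨·, γ_{g−2} ∧ ·⟩`, `P = NS(X)_prim` (negative definite, g44-#1), and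
  **`P^⊥` is a POSITIVE DEFINITE LATTICE OF RANK ONE containing `θ`**, with `[NS : NS_prim ⊕ P^⊥] ∣ |disc NS_prim|` — the divisibility
  complementary to g44-#1's `[NS : ℤθ ⊕ NS_prim] ∣ B₂(θ, θ)` (there the line `ℤθ` is split off first; `P^⊥` is the saturation of `ℤθ` in
  `NS(X)` for `B₂`).
* `p = 2` on an abelian FOURFOLD (§2): `M = Hdg²(X, ℤ) ⊂ H⁴(X, ℤ)` with the cup product `⟨·,·⟩`, `P = Hdg²(X, ℤ)_prim` (positive definite for
  `sign·⟨·,·⟩`, rank `ρ_pr^{(2)} ≤ h_pr^{2,2} = 20`), and **`P^⊥` is a HYPERBOLIC lattice of rank `ρ(X)` and signature `(1, ρ(X) − 1)` for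
  `sign·⟨·,·⟩`, containing `θ ∧ E` for every `E ∈ NS(X)`** — a copy, up to finite index, of the Néron–Severi lattice with its Hodge-index
  signature inside the middle cohomology.

## References

* [cite: VoisinHodgeI2002, §6.3.2 Lemma 6.31, Thm. 6.32 and (6.12) (PDF pp. 128–129); §7.1.2 (PDF p. 134)]
* [cite: Kitaoka1993, Ch. 5 Prop. 5.3.3 (proof)]
* [cite: Huybrechts2016K3, Ch. 14 §0.1 (0.2), §0.2; Ch. 1 §2.2 (Hodge index)]
* [cite: Lange2023AbelianVarietiesComplex, §5.4.1 (5.22)–(5.23) (PDF p. 275); §5.2 Thm. 5.2.4 (PDF p. 262); §7.3.2 (3)]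
-/

noncomputable section

-- `Module ℂ` / `SMulZeroClass ℂ` synthesis on `E [⋀^Fin k]→L[ℝ] ℂ` (as in `ComplexTorusLefschetzDecomposition`)
set_option maxSynthPendingDepth 3

open Module Function Complex
open LinearMap (BilinForm)
open Literature.LinearAlgebra.Alternating
open Literature.Analysis.Complex (IsOfTypeAt typeSubmodule oneForm₀)

namespace Literature.Geometry.Kaehler.ComplexTorus

/-! ## §1 `p = 1`: `NS(X) ⊇ NS(X)_prim ⊕ P^⊥`, `P^⊥` a positive line containing `θ` -/

section DegreeTwo

variable {ι : Type*} [Fintype ι] [DecidableEq ι] {E : Type*} [NormedAddCommGroup E] [NormedSpace ℂ E]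
  {Φ : (ι → ℝ) ≃L[ℝ] E} {j n q : ℕ} {η : E [⋀^Fin 2]→L[ℝ] ℝ} {d : Fin (j + 2) → ℕ}

omit [Fintype ι] [DecidableEq ι] in
/-- `1 ∧ θ = θ` for the unit `0`-form. [folklore] -/
private theorem oneForm₀_wedge_two₈₀ (θ : E [⋀^Fin 2]→L[ℝ] ℂ) : (oneForm₀ E).wedge θ = θ := by
  rw [oneForm₀, ContinuousAlternatingMap.constOfIsEmpty_one_wedge]
  ext v
  rfl

set_option maxHeartbeats 4000000 in
/-- **`p = 1`: inside `NS(X) ≅ Hdg¹(X, ℤ)` with the Lefschetz form `B₂ = ⟨·, γ_{g−2} ∧ ·⟩`, the orthogonal `P^⊥` of the primitive Néron–Severi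
lattice `P = NS(X)_prim` has RANK ONE and `s·B₂∣P^⊥` is POSITIVE (`(b⁺, b⁻) = (1, 0)`); `P ⊓ P^⊥ = 0` and `[NS : P ⊕ P^⊥]` is finite.**
[cite: VoisinHodgeI2002, §6.3.2 Lemma 6.31, Thm. 6.32 (PDF p. 128)] [cite: Lange2023AbelianVarietiesComplex, §5.2 Thm. 5.2.4 (PDF p. 262); §5.4.1 (5.22)] [cite: Kitaoka1993, Ch. 5 Prop. 5.3.3 (proof)] -/
theorem IsPolarizationType.primitive_splitting_two_one (hd : IsPolarizationType Φ η d) (hη : IsRiemannForm Φ η)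
    (hkq : 0 + 2 + q = j + 2) (hq : q ≤ j + 2) {γ : E [⋀^Fin (2 * q)]→L[ℝ] ℂ}
    (hγ : wedgePow (ofRealForm η) q = ((q.factorial * ∏ i : Fin q, d (Fin.castLE hq i) : ℕ) : ℂ) • γ)
    (e : Fin n ≃ ι) (hn : 0 + 2 + (2 * q + (0 + 2)) = n) {B : BilinForm ℤ ↥(integralForms Φ (0 + 2))}
    (hB : ∀ x y : ↥(integralForms Φ (0 + 2)),
      ((B x y : ℤ) : ℂ) = poincarePairing Φ e hn (x : E [⋀^Fin (0 + 2)]→L[ℝ] ℂ) (γ.wedge (y : E [⋀^Fin (0 + 2)]→L[ℝ] ℂ)))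
    {P : Submodule ℤ ↥(AddSubgroup.toIntSubmodule ((integralHodgeClassesIn Φ (0 + 2) 1).addSubgroupOf (integralForms Φ (0 + 2))))}
    (hP : ∀ z, z ∈ P ↔ (((z : ↥(AddSubgroup.toIntSubmodule ((integralHodgeClassesIn Φ (0 + 2) 1).addSubgroupOf
      (integralForms Φ (0 + 2))))) : ↥(integralForms Φ (0 + 2))) : E [⋀^Fin (0 + 2)]→L[ℝ] ℂ) ∈ primitiveForms η (0 + 2)) :
    finrank ℤ ↥((B.restrict (AddSubgroup.toIntSubmodule ((integralHodgeClassesIn Φ (0 + 2) 1).addSubgroupOf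
        (integralForms Φ (0 + 2))))).orthogonal P) = 1 ∧
      sigPos ((((orientationSign Φ e * (-1) ^ q) • B).restrict (AddSubgroup.toIntSubmodule ((integralHodgeClassesIn Φ (0 + 2) 1).addSubgroupOf
        (integralForms Φ (0 + 2))))).restrict ((B.restrict (AddSubgroup.toIntSubmodule ((integralHodgeClassesIn Φ (0 + 2) 1).addSubgroupOf
        (integralForms Φ (0 + 2))))).orthogonal P)).toQuadraticMap = 1 ∧
      sigNeg ((((orientationSign Φ e * (-1) ^ q) • B).restrict (AddSubgroup.toIntSubmodule ((integralHodgeClassesIn Φ (0 + 2) 1).addSubgroupOf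
        (integralForms Φ (0 + 2))))).restrict ((B.restrict (AddSubgroup.toIntSubmodule ((integralHodgeClassesIn Φ (0 + 2) 1).addSubgroupOf
        (integralForms Φ (0 + 2))))).orthogonal P)).toQuadraticMap = 0 := by
  have hrk := hd.finrank_orthogonal_primitive_eq_sum hη (show 1 + 1 = 0 + 2 by rfl) hkq hq hγ e hn hB hP
  have hsig := hd.sigPos_sigNeg_orthogonal_primitive hη (show 1 + 1 = 0 + 2 by rfl) hkq hq hγ e hn hB hP
  have h0 : finrank ℤ ↥(integralHodgeClassesIn Φ (2 * 0) 0 ⊓ (primitiveForms η (2 * 0)).toAddSubgroup) = 1 := by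
    rw [finrank_integralHodgeClassesIn_inf_primitiveForms_congr Φ η (Nat.mul_zero 2) 0, finrank_integralHodgeClassesIn_inf_primitiveForms_zero Φ η]
  rw [Finset.sum_range_one, h0] at hrk
  have ho0 : ¬ Odd 0 := Nat.not_odd_iff_even.2 ⟨0, rfl⟩
  simp only [Finset.sum_filter] at hsig
  rw [Finset.sum_range_one, Finset.sum_range_one, if_pos ⟨0, rfl⟩, if_neg ho0, h0] at hsig
  exact ⟨hrk, hsig⟩

/-- **`p = 1`: `θ ∈ P^⊥`** — the polarisation class is `B₂`-orthogonal to the primitive Néron–Severi lattice (`θ = 1 ∧ θ` is a Lefschetz class;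
Voisin's Lemma 6.31 over `ℤ`), so `P^⊥` is the saturation of `ℤθ` in `NS(X)` for `B₂`.
[cite: VoisinHodgeI2002, §6.3.2 Lemma 6.31 (PDF p. 128)] [cite: Lange2023AbelianVarietiesComplex, §5.4.1 (5.22) (PDF p. 275)] -/
theorem IsPolarizationType.mem_orthogonal_primitive_two_one_of_eq_ofRealForm (hd : IsPolarizationType Φ η d) (hη : IsRiemannForm Φ η)
    (hkq : 0 + 2 + q = j + 2) (hq : q ≤ j + 2) {γ : E [⋀^Fin (2 * q)]→L[ℝ] ℂ}
    (hγ : wedgePow (ofRealForm η) q = ((q.factorial * ∏ i : Fin q, d (Fin.castLE hq i) : ℕ) : ℂ) • γ)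
    (e : Fin n ≃ ι) (hn : 0 + 2 + (2 * q + (0 + 2)) = n) {B : BilinForm ℤ ↥(integralForms Φ (0 + 2))}
    (hB : ∀ x y : ↥(integralForms Φ (0 + 2)),
      ((B x y : ℤ) : ℂ) = poincarePairing Φ e hn (x : E [⋀^Fin (0 + 2)]→L[ℝ] ℂ) (γ.wedge (y : E [⋀^Fin (0 + 2)]→L[ℝ] ℂ)))
    {P : Submodule ℤ ↥(AddSubgroup.toIntSubmodule ((integralHodgeClassesIn Φ (0 + 2) 1).addSubgroupOf (integralForms Φ (0 + 2))))}
    (hP : ∀ z, z ∈ P ↔ (((z : ↥(AddSubgroup.toIntSubmodule ((integralHodgeClassesIn Φ (0 + 2) 1).addSubgroupOf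
      (integralForms Φ (0 + 2))))) : ↥(integralForms Φ (0 + 2))) : E [⋀^Fin (0 + 2)]→L[ℝ] ℂ) ∈ primitiveForms η (0 + 2))
    {x : ↥(AddSubgroup.toIntSubmodule ((integralHodgeClassesIn Φ (0 + 2) 1).addSubgroupOf (integralForms Φ (0 + 2))))}
    (hx : ((x : ↥(integralForms Φ (0 + 2))) : E [⋀^Fin (0 + 2)]→L[ℝ] ℂ) = ofRealForm η) :
    x ∈ (B.restrict (AddSubgroup.toIntSubmodule ((integralHodgeClassesIn Φ (0 + 2) 1).addSubgroupOf (integralForms Φ (0 + 2))))).orthogonal P := by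
  refine hd.mem_orthogonal_primitive_of_eq_wedge_ofRealForm hη (show 1 + 1 = 0 + 2 by rfl) hkq hq hγ e hn hB hP
    (y := ⟨oneForm₀ E, (oneForm₀_mem_integralHodgeClasses Φ).1⟩) ?_
  rw [hx]
  exact (oneForm₀_wedge_two₈₀ _).symm

end DegreeTwo

/-! ## §2 `p = 2` on an abelian fourfold: `P^⊥ ⊂ Hdg²(X, ℤ)` is hyperbolic of rank `ρ(X)`, signature `(1, ρ − 1)`, `∋ θ ∧ NS(X)` -/

section Fourfold

variable {ι : Type*} [Fintype ι] [DecidableEq ι] {E : Type*} [NormedAddCommGroup E] [NormedSpace ℂ E]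
  {Φ : (ι → ℝ) ≃L[ℝ] E} {n : ℕ} {η : E [⋀^Fin 2]→L[ℝ] ℝ} {d : Fin (2 + 2) → ℕ}

omit [Fintype ι] [DecidableEq ι] in
/-- The polarisation class in degree `0`: `θ⁰ = 0!·(empty product)·θ⁰`. [folklore] -/
private theorem wedgePow_zero_eq_smul₈₀ (η : E [⋀^Fin 2]→L[ℝ] ℝ) (d : Fin (2 + 2) → ℕ) :
    wedgePow (ofRealForm η) 0 =
      (((0 : ℕ).factorial * ∏ i : Fin 0, d (Fin.castLE (show 0 ≤ 2 + 2 by omega) i) : ℕ) : ℂ) • wedgePow (ofRealForm η) 0 := by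
  simp

set_option maxHeartbeats 4000000 in
/-- **ABELIAN FOURFOLD: inside the middle Hodge lattice `Hdg²(X, ℤ) ⊂ H⁴(X, ℤ)` (cup product `⟨·,·⟩`), the orthogonal `P^⊥` of the primitive
Hodge lattice `P = Hdg²(X, ℤ)_prim` is a lattice of RANK `ρ(X) = rk NS(X)` on which `sign·⟨·,·⟩` has the HODGE-INDEX SIGNATURE `(1, ρ(X) − 1)`;
`P ⊓ P^⊥ = 0`, `[Hdg² : P ⊕ P^⊥]` is finite and divides `|det G_P|`** (`P` itself is positive definite of rank `ρ_pr^{(2)} ≤ 20`, g45-#2 / g46-#4).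
[cite: VoisinHodgeI2002, §6.3.2 Lemma 6.31, Thm. 6.32 and (6.12) (PDF pp. 128–129)] [cite: Lange2023AbelianVarietiesComplex, §5.2 Thm. 5.2.4 (PDF p. 262); §5.4.1 (5.22)] [cite: Kitaoka1993, Ch. 5 Prop. 5.3.3 (proof)] [cite: Huybrechts2016K3, Ch. 14 §0.2] -/
theorem IsPolarizationType.primitive_splitting_middle_fourfold (hd : IsPolarizationType Φ η d) (hη : IsRiemannForm Φ η)
    (e : Fin n ≃ ι) (hn : 2 + 2 + (2 * 0 + (2 + 2)) = n) {B : BilinForm ℤ ↥(integralForms Φ (2 + 2))}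
    (hB : ∀ x y : ↥(integralForms Φ (2 + 2)),
      ((B x y : ℤ) : ℂ) = poincarePairing Φ e hn (x : E [⋀^Fin (2 + 2)]→L[ℝ] ℂ) ((wedgePow (ofRealForm η) 0).wedge (y : E [⋀^Fin (2 + 2)]→L[ℝ] ℂ)))
    {P : Submodule ℤ ↥(AddSubgroup.toIntSubmodule ((integralHodgeClassesIn Φ (2 + 2) 2).addSubgroupOf (integralForms Φ (2 + 2))))}
    (hP : ∀ z, z ∈ P ↔ (((z : ↥(AddSubgroup.toIntSubmodule ((integralHodgeClassesIn Φ (2 + 2) 2).addSubgroupOf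
      (integralForms Φ (2 + 2))))) : ↥(integralForms Φ (2 + 2))) : E [⋀^Fin (2 + 2)]→L[ℝ] ℂ) ∈ primitiveForms η (2 + 2)) :
    finrank ℤ ↥((B.restrict (AddSubgroup.toIntSubmodule ((integralHodgeClassesIn Φ (2 + 2) 2).addSubgroupOf
        (integralForms Φ (2 + 2))))).orthogonal P) = finrank ℤ ↥(neronSeveriGroup Φ) ∧
      sigPos ((((orientationSign Φ e) • B).restrict (AddSubgroup.toIntSubmodule ((integralHodgeClassesIn Φ (2 + 2) 2).addSubgroupOf
        (integralForms Φ (2 + 2))))).restrict ((B.restrict (AddSubgroup.toIntSubmodule ((integralHodgeClassesIn Φ (2 + 2) 2).addSubgroupOf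
        (integralForms Φ (2 + 2))))).orthogonal P)).toQuadraticMap = 1 ∧
      sigNeg ((((orientationSign Φ e) • B).restrict (AddSubgroup.toIntSubmodule ((integralHodgeClassesIn Φ (2 + 2) 2).addSubgroupOf
        (integralForms Φ (2 + 2))))).restrict ((B.restrict (AddSubgroup.toIntSubmodule ((integralHodgeClassesIn Φ (2 + 2) 2).addSubgroupOf
        (integralForms Φ (2 + 2))))).orthogonal P)).toQuadraticMap + 1 = finrank ℤ ↥(neronSeveriGroup Φ) ∧
      P ⊓ (B.restrict (AddSubgroup.toIntSubmodule ((integralHodgeClassesIn Φ (2 + 2) 2).addSubgroupOf (integralForms Φ (2 + 2))))).orthogonal P = ⊥ ∧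
      0 < (P ⊔ (B.restrict (AddSubgroup.toIntSubmodule ((integralHodgeClassesIn Φ (2 + 2) 2).addSubgroupOf
        (integralForms Φ (2 + 2))))).orthogonal P).toAddSubgroup.index := by
  have hγ := wedgePow_zero_eq_smul₈₀ η d
  have hrk := hd.finrank_orthogonal_primitive_eq_finrank_integralHodgeClassesIn hη (show 2 + 2 = 2 + 2 by rfl) (show 2 + 2 + 0 = 2 + 2 by rfl)
    (by omega) hγ e hn hB hP (p₁ := 1) (by rfl)
  have hsig := hd.sigPos_sigNeg_orthogonal_primitive hη (show 2 + 2 = 2 + 2 by rfl) (show 2 + 2 + 0 = 2 + 2 by rfl) (by omega) hγ e hn hB hP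
  have hsplit := hd.primitive_splitting hη (show 2 + 2 = 2 + 2 by rfl) (show 2 + 2 + 0 = 2 + 2 by rfl) (by omega) hγ e hn hB hP
  have hNS := finrank_neronSeveriGroup_eq_finrank_integralHodgeClassesIn_two_one Φ
  have hNS1 := hd.finrank_neronSeveriGroup_eq_one_add hη
  have h0 : finrank ℤ ↥(integralHodgeClassesIn Φ (2 * 0) 0 ⊓ (primitiveForms η (2 * 0)).toAddSubgroup) = 1 := by
    rw [finrank_integralHodgeClassesIn_inf_primitiveForms_congr Φ η (Nat.mul_zero 2) 0, finrank_integralHodgeClassesIn_inf_primitiveForms_zero Φ η]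
  have h1 : finrank ℤ ↥(integralHodgeClassesIn Φ (2 * 1) 1 ⊓ (primitiveForms η (2 * 1)).toAddSubgroup) =
      finrank ℤ ↥(integralHodgeClassesIn Φ 2 1 ⊓ (primitiveForms η 2).toAddSubgroup) :=
    finrank_integralHodgeClassesIn_inf_primitiveForms_congr Φ η (Nat.mul_one 2) 1
  have ho0 : ¬ Odd 0 := Nat.not_odd_iff_even.2 ⟨0, rfl⟩
  have he1 : ¬ Even 1 := Nat.not_even_iff_odd.2 odd_one
  simp only [Finset.sum_filter, Finset.sum_range_succ, Finset.sum_range_zero, zero_add] at hsig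
  rw [if_pos ⟨0, rfl⟩, if_neg he1, if_neg ho0, if_pos odd_one, add_zero, zero_add, h0, h1, pow_zero, mul_one] at hsig
  refine ⟨hrk.trans hNS.symm, hsig.1, ?_, hsplit.1, hsplit.2.2.2⟩
  rw [hsig.2, hNS1, add_comm]

/-- **ABELIAN FOURFOLD: `θ ∧ E ∈ P^⊥` for every `E ∈ NS(X)`** — the Lefschetz images of the divisor classes lie in the rank-`ρ(X)` hyperbolic
piece of `Hdg²(X, ℤ)`, orthogonal to all primitive integral Hodge classes of codimension `2`.
[cite: VoisinHodgeI2002, §6.3.2 Lemma 6.31 (PDF p. 128)] [cite: Lange2023AbelianVarietiesComplex, §5.4.1 (5.22) (PDF p. 275)] -/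
theorem IsPolarizationType.mem_orthogonal_primitive_middle_fourfold_of_eq_wedge (hd : IsPolarizationType Φ η d) (hη : IsRiemannForm Φ η)
    (e : Fin n ≃ ι) (hn : 2 + 2 + (2 * 0 + (2 + 2)) = n) {B : BilinForm ℤ ↥(integralForms Φ (2 + 2))}
    (hB : ∀ x y : ↥(integralForms Φ (2 + 2)),
      ((B x y : ℤ) : ℂ) = poincarePairing Φ e hn (x : E [⋀^Fin (2 + 2)]→L[ℝ] ℂ) ((wedgePow (ofRealForm η) 0).wedge (y : E [⋀^Fin (2 + 2)]→L[ℝ] ℂ)))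
    {P : Submodule ℤ ↥(AddSubgroup.toIntSubmodule ((integralHodgeClassesIn Φ (2 + 2) 2).addSubgroupOf (integralForms Φ (2 + 2))))}
    (hP : ∀ z, z ∈ P ↔ (((z : ↥(AddSubgroup.toIntSubmodule ((integralHodgeClassesIn Φ (2 + 2) 2).addSubgroupOf
      (integralForms Φ (2 + 2))))) : ↥(integralForms Φ (2 + 2))) : E [⋀^Fin (2 + 2)]→L[ℝ] ℂ) ∈ primitiveForms η (2 + 2))
    {x : ↥(AddSubgroup.toIntSubmodule ((integralHodgeClassesIn Φ (2 + 2) 2).addSubgroupOf (integralForms Φ (2 + 2))))}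
    {ψ : E [⋀^Fin 2]→L[ℝ] ℝ} (hψ : IsNSForm Φ ψ)
    (hx : ((x : ↥(integralForms Φ (2 + 2))) : E [⋀^Fin (2 + 2)]→L[ℝ] ℂ) = (ofRealForm ψ).wedge (ofRealForm η)) :
    x ∈ (B.restrict (AddSubgroup.toIntSubmodule ((integralHodgeClassesIn Φ (2 + 2) 2).addSubgroupOf (integralForms Φ (2 + 2))))).orthogonal P :=
  hd.mem_orthogonal_primitive_of_eq_wedge_ofRealForm hη (show 2 + 2 = 2 + 2 by rfl) (show 2 + 2 + 0 = 2 + 2 by rfl) (by omega)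
    (wedgePow_zero_eq_smul₈₀ η d) e hn hB hP (y := ⟨ofRealForm ψ, ofRealForm_mem_integralForms_two Φ hψ⟩) hx

end Fourfold

end Literature.Geometry.Kaehler.ComplexTorus

end
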